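import Literature.AlgebraicGeometry.Frobenioids.GaloisEquivariantUnitsEndomorphismRigidity
import HarnessLib

/-!
# Frobenioids I, Example 6.3: the Galois-equivariant units-endomorphism rigidity OVER AN INTERMEDIATE BASE — equivariance
# under `Gal(K/K')` only (`K'/F` finite), relabelled places of `K'`

Mochizuki, *The geometry of Frobenioids I: the general theory*, Kyushu J. Math. **62** (2008) 293–400, §6, Example 6.3
pp. 112–114 (the rational-function monoid `B : Spec L ↦ L^×` on `D = B(Gal(F̃/F))⁰` and `f ↦ div(f)`)
[cite: MochizukiFrdI2008, Ex. 6.3 p.113].  CLASSICAL LEMMA (OURS): no [IUTchI] / [FrdI] statement is asserted.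

PROOF-ONLY sequel (cell abc-iut, seat abc-iut-L5-t16 gen 13; (b)-side service for the `⊚`-slot row «HBCIRC-PUSH» of
abc-iut-L5-t11, abc-iut-L5-lead RULINGS #179) of `GaloisEquivariantUnitsEndomorphismRigidity.lean`
(`eq_id_of_galEquivariant_of_ordFin_perm`: base field `F`, equivariance under ALL of `Gal(K/F)`).  At the `⊚`-carrier
`†𝒟^⊚ = ℬ(H)⁰ → ℬ(G_F)⁰` induced by an open embedding `ι : H ↪ G_F` the glued endomorphism of `K^× = F̄^×` is equivariant only
under the image `Γ = ι(H)`, an open (hence closed, finite-index) subgroup of `Gal(K/F)`, and the divisor law is read on the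
fixed field `K' = K^Γ`, a finite extension of `F`.  THIS FILE restates the rigidity in exactly that currency — it is the SAME
theorem over the number field `K'` (`Gal(K/K') = Γ` by the infinite Galois correspondence; `F` itself need only be a field):

* `eq_id_of_equivariant_intermediateField_of_ordFin_perm` — `K' : IntermediateField F K` a number field; `ᾱ` commuting with
  every `σ ∈ Gal(K/F)` FIXING `K'` pointwise (`σ ∈ K'.fixingSubgroup`); `θ` a permutation of `FinitePlace K'` with
  `ord_{θ w}(ᾱ u) = ord_w(u)` on `K'^×` ⟹ `ᾱ = id`;
* `eq_id_of_equivariant_closedSubgroup_of_ordFin_perm` — the same with the equivariance group a CLOSED subgroup `Γ ≤ Gal(K/F)`,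
  `K' := K^Γ` (`Gal(K/K^Γ) = Γ`, `InfiniteGalois.fixingSubgroup_fixedField`);
* `numberField_fixedField_of_isOpen` — `Γ` open ⟹ `K^Γ` is a number field (`InfiniteGalois.isOpen_iff_finite`);
* `eq_id_of_equivariant_openSubgroup_of_ordFin_perm` — `Γ` OPEN: equivariance under `Γ` only ⟹ `ᾱ = id` — the `⊚`-carrier
  shape `Γ = ι(H)`.
Nothing here bears on, or takes a side on, [IUTchIII] Cor. 3.12; nothing here asserts anything about abc.
-/

noncomputable section

namespace Literature.AlgebraicGeometry.Frobenioids

open NumberField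

variable {F : Type} [Field F] {K : Type} [Field K] [Algebra F K] [IsGalois F K]

/-- **Rigidity over an intermediate base.**  `K/F` Galois with `K` algebraically closed, `K' ⊆ K` an intermediate field
a number field (e.g. finite over the number field `F`: `NumberField.of_module_finite`); an endomorphism `ᾱ` of `K^×` commuting
with every `σ ∈ Gal(K/F)` that fixes `K'` pointwise,
and a permutation `θ` of the finite places of `K'` with `ord_{θ w}(ᾱ u) = ord_w(u)` for all `u ∈ K'^×`: then `ᾱ = id`
(`eq_id_of_galEquivariant_of_ordFin_perm` over the number field `K'`, through `Gal(K/K') ↪ Gal(K/F)` by restriction of scalars).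
[cite: MochizukiFrdI2008, Ex. 6.3 p.113] -/
theorem eq_id_of_equivariant_intermediateField_of_ordFin_perm [IsAlgClosed K] (K' : IntermediateField F K) [NumberField K']
    (ᾱ : Kˣ →* Kˣ)
    (hσ : ∀ σ : K ≃ₐ[F] K, σ ∈ K'.fixingSubgroup →
      ∀ x : Kˣ, ᾱ (Units.map (σ : K →* K) x) = Units.map (σ : K →* K) (ᾱ x))
    (θ : Equiv.Perm (FinitePlace K'))
    (hval : ∀ u : K'ˣ, ∃ u' : K'ˣ,
      Units.map (algebraMap K' K : K' →* K) u' = ᾱ (Units.map (algebraMap K' K : K' →* K) u) ∧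
        ∀ w : FinitePlace K', ordFin K' (θ w) u' = ordFin K' w u) :
    ᾱ = MonoidHom.id Kˣ := by
  haveI : IsGalois K' K := IsGalois.tower_top_of_isGalois F K' K
  refine eq_id_of_galEquivariant_of_ordFin_perm (F := K') ᾱ (fun σ x => ?_) θ hval
  -- `σ : K ≃ₐ[K'] K` restricted to `F`-scalars fixes `K'` pointwise
  have hmem : σ.restrictScalars F ∈ K'.fixingSubgroup := by
    rw [IntermediateField.mem_fixingSubgroup_iff]
    intro y hy
    exact σ.commutes (⟨y, hy⟩ : K')
  exact hσ (σ.restrictScalars F) hmem x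

/-- **Rigidity over the fixed field of a CLOSED subgroup.**  The same with the equivariance group given as a closed subgroup
`Γ ≤ Gal(K/F)` whose fixed field `K^Γ` is a number field (e.g. `Γ` OPEN — the image of an open embedding `ι : H ↪ G_F`; open
subgroups are closed, and `K^Γ` is then a number field: `numberField_fixedField_of_isOpen`): an endomorphism `ᾱ` of `K^×` commuting
with every `σ ∈ Γ` ONLY, and relabelling the finite places of `K^Γ` on `(K^Γ)^×`, is the identity — `Gal(K/K^Γ) = Γ`
(`InfiniteGalois.fixingSubgroup_fixedField`). [cite: MochizukiFrdI2008, Ex. 6.3 p.113] -/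
theorem eq_id_of_equivariant_closedSubgroup_of_ordFin_perm [IsAlgClosed K] (Γ : ClosedSubgroup (K ≃ₐ[F] K))
    [NumberField (IntermediateField.fixedField (Γ : Subgroup (K ≃ₐ[F] K)))] (ᾱ : Kˣ →* Kˣ)
    (hσ : ∀ σ : K ≃ₐ[F] K, σ ∈ (Γ : Subgroup (K ≃ₐ[F] K)) →
      ∀ x : Kˣ, ᾱ (Units.map (σ : K →* K) x) = Units.map (σ : K →* K) (ᾱ x))
    (θ : Equiv.Perm (FinitePlace (IntermediateField.fixedField (Γ : Subgroup (K ≃ₐ[F] K)))))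
    (hval : ∀ u : (IntermediateField.fixedField (Γ : Subgroup (K ≃ₐ[F] K)))ˣ,
      ∃ u' : (IntermediateField.fixedField (Γ : Subgroup (K ≃ₐ[F] K)))ˣ,
        Units.map (algebraMap (IntermediateField.fixedField (Γ : Subgroup (K ≃ₐ[F] K))) K : _ →* K) u' =
            ᾱ (Units.map (algebraMap (IntermediateField.fixedField (Γ : Subgroup (K ≃ₐ[F] K))) K : _ →* K) u) ∧
          ∀ w : FinitePlace (IntermediateField.fixedField (Γ : Subgroup (K ≃ₐ[F] K))),
            ordFin (IntermediateField.fixedField (Γ : Subgroup (K ≃ₐ[F] K))) (θ w) u' =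
              ordFin (IntermediateField.fixedField (Γ : Subgroup (K ≃ₐ[F] K))) w u) :
    ᾱ = MonoidHom.id Kˣ :=
  eq_id_of_equivariant_intermediateField_of_ordFin_perm (IntermediateField.fixedField (Γ : Subgroup (K ≃ₐ[F] K))) ᾱ
    (fun σ hmem x => hσ σ (by rwa [InfiniteGalois.fixingSubgroup_fixedField Γ] at hmem) x) θ hval

/-- The fixed field of an OPEN subgroup of `Gal(K/F)` (`K/F` Galois, `F` a number field) is a number field: open subgroups are
closed, `Gal(K/K^Γ) = Γ` (`InfiniteGalois.fixingSubgroup_fixedField`), and an intermediate field with open fixing subgroup is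
finite over `F` (`InfiniteGalois.isOpen_iff_finite`) — Krull's correspondence «the open subgroups of `G(Ω|k)` correspond
precisely to the finite subextensions of `Ω|k`». [cite: NeukirchANT1999, Ch. IV Thm. (1.2) p.263] -/
theorem numberField_fixedField_of_isOpen [NumberField F] (Γ : Subgroup (K ≃ₐ[F] K)) (hΓ : IsOpen (Γ : Set (K ≃ₐ[F] K))) :
    NumberField (IntermediateField.fixedField Γ) := by
  let Γc : ClosedSubgroup (K ≃ₐ[F] K) := ⟨Γ, Subgroup.isClosed_of_isOpen Γ hΓ⟩
  have hfix : (IntermediateField.fixedField Γ).fixingSubgroup = Γ := InfiniteGalois.fixingSubgroup_fixedField Γc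
  haveI : FiniteDimensional F (IntermediateField.fixedField Γ) := by
    rw [← InfiniteGalois.isOpen_iff_finite, hfix]
    exact hΓ
  exact NumberField.of_module_finite F _

/-- **Rigidity for an OPEN equivariance group** (the `⊚`-carrier shape: `Γ = ι(H)` for an open embedding `ι : H ↪ G_F`):
`Γ ≤ Gal(K/F)` open, `ᾱ` commuting with every `σ ∈ Γ` ONLY, `θ` relabelling the finite places of the number field `K^Γ`
(`numberField_fixedField_of_isOpen`) on `(K^Γ)^×` ⟹ `ᾱ = id`. [cite: MochizukiFrdI2008, Ex. 6.3 p.113] -/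
theorem eq_id_of_equivariant_openSubgroup_of_ordFin_perm [IsAlgClosed K] (Γ : Subgroup (K ≃ₐ[F] K))
    (hΓ : IsOpen (Γ : Set (K ≃ₐ[F] K))) [NumberField (IntermediateField.fixedField Γ)] (ᾱ : Kˣ →* Kˣ)
    (hσ : ∀ σ : K ≃ₐ[F] K, σ ∈ Γ → ∀ x : Kˣ, ᾱ (Units.map (σ : K →* K) x) = Units.map (σ : K →* K) (ᾱ x))
    (θ : Equiv.Perm (FinitePlace (IntermediateField.fixedField Γ)))
    (hval : ∀ u : (IntermediateField.fixedField Γ)ˣ, ∃ u' : (IntermediateField.fixedField Γ)ˣ,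
      Units.map (algebraMap (IntermediateField.fixedField Γ) K : _ →* K) u' =
          ᾱ (Units.map (algebraMap (IntermediateField.fixedField Γ) K : _ →* K) u) ∧
        ∀ w : FinitePlace (IntermediateField.fixedField Γ),
          ordFin (IntermediateField.fixedField Γ) (θ w) u' = ordFin (IntermediateField.fixedField Γ) w u) :
    ᾱ = MonoidHom.id Kˣ := by
  let Γc : ClosedSubgroup (K ≃ₐ[F] K) := ⟨Γ, Subgroup.isClosed_of_isOpen Γ hΓ⟩
  have hfix : (IntermediateField.fixedField Γ).fixingSubgroup = Γ := InfiniteGalois.fixingSubgroup_fixedField Γc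
  exact eq_id_of_equivariant_intermediateField_of_ordFin_perm (IntermediateField.fixedField Γ) ᾱ
    (fun σ hmem x => hσ σ (by rwa [hfix] at hmem) x) θ hval

end Literature.AlgebraicGeometry.Frobenioids

end
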